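import Mathlib
import HarnessLib
import Summits.AtomisticToContinuum.FouriersLaw.Theses.StaticAbelianSqueeze
import Summits.AtomisticToContinuum.FouriersLaw.Theorems.JunctionLocalityConductanceLowerBoundStubBulkAbelFloorOfHeatVarianceBets

/-!
# (A⁻) on the bet route StaticAbelianSqueeze: the open-chain Abel floor from the route's own resolvent squeeze (S)
# and a STATIC Abel floor of the primal functional (crux stmt-AtomisticToContinuum-11749, line `abel-floor-exchange`, lead c6)

Support file (`--supports stmt-AtomisticToContinuum-11749`; closes nothing).

On route StaticAbelianSqueeze the shared positivity crux (P) = `ConductanceLowerBound` is taken as a hypothesis of `closes`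
next to (K) `KuboAbelIdentity` (stmt-13419, PROVED), (S) `ResolventSqueeze` (stmt-13417), (G) `LiouvilleNoGap` (stmt-13418)
and (R) `UniformAbelianRegularity` (stmt-13416).  The route thesis names — but does not file — "the positivity-from-statics
alternative to (P): a ν-dependent slow-mode test family `g_ν` with `‖𝒜g_ν‖² ≪ ν`, i.e. `K_(0⁺) > 0`".  This file makes that
alternative a kernel-checked reduction in the vocabulary of (S):

* `openChainAbelFloor_of_resolventSqueeze_of_staticAbelFloor` — (S) together with a STATIC ABEL FLOOR (for every `T > 0` a
  shift-invariant DLR state `μ_T` and `a, ν₀ > 0` such that for every `ν ∈ (0, ν₀)` SOME local test function `g` has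
  `PRIMAL_ν(g) = 2⟨⟨j,g⟩⟩ − ν⟨⟨g,g⟩⟩ − ν⁻¹⟨⟨𝒜g,𝒜g⟩⟩ ≥ a`, brackets `⟨⟨f₁,f₂⟩⟩ = Σ_x Cov_{μ_T}(f₁, f₂∘τ_x)` exactly as in
  (S)) give stub (A⁻) `stub_openChainAbelFloor` of line `abel-floor-exchange`: the lower inequality of (S) at `ε = a/2` reads
  `(N−1)·a/2 ≤ F_N(ν)` eventually in `N`, and `(N−1)/2 ≥ N/4` for `N ≥ 2`.  No dynamics of the infinite chain, no tightness,
  no matching theorem is used — the static floor is consumed through (S) alone.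
* `conductanceLowerBound_of_resolventSqueeze_staticAbelFloor_regularity` — hence (S) ∧ static Abel floor ∧ (R) ⟹
  `StaticAbelianSqueeze.ConductanceLowerBound`, by the landed composition of the line
  (`conductanceLowerBound_of_abelFloor_and_signedSlowRegularity`, `slowRegularity_signed_of_uniformAbelianRegularity`, p156938).

So on the bet route the child stmt-11749 reduces to the route's OWN items (S), (R) plus one static variational positivity
statement (an `ℋ₋₁`-type lower bound for the current in the infinite Gibbs state, uniform in small `ν`) — the honest bulk
content of (P) in this route's language.  References: Bernardin–Olla 2011 §6 (variational formula); Kundu–Dhar–Narayan 2009.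
No definitions, no named facts, no sorry.
-/

noncomputable section

open MeasureTheory Filter Set Topology
open Literature.MathematicalPhysics.KineticTheory.HeatConduction

namespace Summit.AtomisticToContinuum.FouriersLaw.Cruxes.ConductanceLowerBound.AbelFloorExchange

/-- **(A⁻) from (S) and a static Abel floor of the primal functional.**  If `ResolventSqueeze` holds and for all parameters
`> 0` and `T > 0` there are a shift-invariant DLR state `μ_T` and `a, ν₀ > 0` such that for every `ν ∈ (0, ν₀)` some local
test function `g` has `a ≤ 2⟨⟨j,g⟩⟩ − ν⟨⟨g,g⟩⟩ − ν⁻¹⟨⟨𝒜g,𝒜g⟩⟩`, then the open chain's Abel-regularised Green–Kubo integral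
obeys `(a/4)·N ≤ F_N(ν)` eventually in `N`, for every `ν ∈ (0, ν₀)`. [cite: BernardinOlla2011, §6] -/
theorem openChainAbelFloor_of_resolventSqueeze_of_staticAbelFloor
    (hS : Summit.AtomisticToContinuum.FouriersLaw.Theses.StaticAbelianSqueeze.ResolventSqueeze)
    (hF : ∀ ω₂ lam β γ : ℝ, 0 < ω₂ → 0 < lam → 0 < β → 0 < γ → ∀ T : ℝ, 0 < T →
      ∃ μT : Measure ChainConfig, (pinnedChain ω₂ lam β γ).IsChainGibbsMeasure T μT ∧ IsShiftInvariant μT ∧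
        ∃ a ν₀ : ℝ, 0 < a ∧ 0 < ν₀ ∧ ∀ ν : ℝ, 0 < ν → ν < ν₀ →
          ∃ g : ChainConfig → ℝ, IsLocalTestFunction g ∧
            a ≤ 2 * (∑' x : ℤ, ((∫ σ, (pinnedChain ω₂ lam β γ).bondCurrentZ σ 0 * g (fun i => σ (i + x)) ∂μT) -
                      (∫ σ, (pinnedChain ω₂ lam β γ).bondCurrentZ σ 0 ∂μT) * (∫ σ, g σ ∂μT)))
                - ν * (∑' x : ℤ, ((∫ σ, g σ * g (fun i => σ (i + x)) ∂μT) - (∫ σ, g σ ∂μT) * (∫ σ, g σ ∂μT)))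
                - ν⁻¹ * (∑' x : ℤ, ((∫ σ, (pinnedChain ω₂ lam β γ).liouvilleZ g σ *
                      (pinnedChain ω₂ lam β γ).liouvilleZ g (fun i => σ (i + x)) ∂μT) -
                    (∫ σ, (pinnedChain ω₂ lam β γ).liouvilleZ g σ ∂μT) *
                      (∫ σ, (pinnedChain ω₂ lam β γ).liouvilleZ g σ ∂μT)))) :
    ∀ ω₂ lam β γ : ℝ, 0 < ω₂ → 0 < lam → 0 < β → 0 < γ → ∀ T : ℝ, 0 < T →
      ∃ a : ℝ, 0 < a ∧ ∃ ν₀ : ℝ, 0 < ν₀ ∧ ∀ ν : ℝ, 0 < ν → ν < ν₀ → ∃ N₀ : ℕ, ∀ N : ℕ, N₀ ≤ N →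
        a * N ≤ ∫ t in Set.Ioi (0:ℝ), Real.exp (-(ν * t)) *
          ∫ z, (∑ i : Fin N, (pinnedChain ω₂ lam β γ).bondCurrent N i z) *
            (∫ y, (∑ i : Fin N, (pinnedChain ω₂ lam β γ).bondCurrent N i y)
              ∂((pinnedChain ω₂ lam β γ).transitionKernel N T T t.toNNReal z))
            ∂((pinnedChain ω₂ lam β γ).gibbsMeasure N T) := by
  intro ω₂ lam β γ hω hl hβ hγ T hT
  obtain ⟨μT, hG, hSI, a, ν₀, ha, hν₀, hfloor⟩ := hF ω₂ lam β γ hω hl hβ hγ T hT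
  refine ⟨a / 4, by positivity, ν₀, hν₀, fun ν hν hlt => ?_⟩
  obtain ⟨g, hg, hag⟩ := hfloor ν hν hlt
  -- the lower inequality of the resolvent squeeze at (ν, g, u := g, ε := a/2)
  have hSq := hS ω₂ lam β γ hω hl hβ hγ T hT μT hG hSI ν hν g g hg hg (a / 2) (by positivity)
  obtain ⟨N₀, hN₀⟩ := hSq
  refine ⟨max N₀ 2, fun N hN => ?_⟩
  have hN₀N : N₀ ≤ N := le_trans (le_max_left _ _) hN
  have hN2 : (2:ℕ) ≤ N := le_trans (le_max_right _ _) hN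
  have hlow := (hN₀ N hN₀N).1
  -- unfold the `let`s of (S): its primal value is the expression bounded below by `a`
  simp only [] at hlow
  have hN2' : (2:ℝ) ≤ N := by exact_mod_cast hN2
  have hprim : ((N:ℝ) - 1) * (a - a / 2) ≤ ((N:ℝ) - 1) *
      ((2 * (∑' x : ℤ, ((∫ σ, (pinnedChain ω₂ lam β γ).bondCurrentZ σ 0 * g (fun i => σ (i + x)) ∂μT) -
            (∫ σ, (pinnedChain ω₂ lam β γ).bondCurrentZ σ 0 ∂μT) * (∫ σ, g σ ∂μT)))
        - ν * (∑' x : ℤ, ((∫ σ, g σ * g (fun i => σ (i + x)) ∂μT) - (∫ σ, g σ ∂μT) * (∫ σ, g σ ∂μT)))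
        - ν⁻¹ * (∑' x : ℤ, ((∫ σ, (pinnedChain ω₂ lam β γ).liouvilleZ g σ *
              (pinnedChain ω₂ lam β γ).liouvilleZ g (fun i => σ (i + x)) ∂μT) -
            (∫ σ, (pinnedChain ω₂ lam β γ).liouvilleZ g σ ∂μT) *
              (∫ σ, (pinnedChain ω₂ lam β γ).liouvilleZ g σ ∂μT)))) - a / 2) :=
    mul_le_mul_of_nonneg_left (by linarith) (by linarith)
  have key : ((N:ℝ) - 1) * (a - a / 2) ≤ ∫ t in Set.Ioi (0:ℝ), Real.exp (-(ν * t)) *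
      ∫ z, (∑ i : Fin N, (pinnedChain ω₂ lam β γ).bondCurrent N i z) *
        (∫ y, (∑ i : Fin N, (pinnedChain ω₂ lam β γ).bondCurrent N i y)
          ∂((pinnedChain ω₂ lam β γ).transitionKernel N T T t.toNNReal z))
        ∂((pinnedChain ω₂ lam β γ).gibbsMeasure N T) := le_trans hprim hlow
  have h4 : a / 4 * N ≤ ((N:ℝ) - 1) * (a - a / 2) := by nlinarith
  exact le_trans h4 key

/-- **`StaticAbelianSqueeze.ConductanceLowerBound` from (S), a static Abel floor and (R).**  On the bet route the child
stmt-11749 follows from `ResolventSqueeze` (stmt-13417), the static Abel floor of the primal functional (hypothesis, in the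
vocabulary of (S)) and `UniformAbelianRegularity` (stmt-13416, lower half only), by the landed composition of line
`abel-floor-exchange` (Kubo identity (K) + Abelian split). [cite: KunduDharNarayan2009, p. 3] -/
theorem conductanceLowerBound_of_resolventSqueeze_staticAbelFloor_regularity
    (hS : Summit.AtomisticToContinuum.FouriersLaw.Theses.StaticAbelianSqueeze.ResolventSqueeze)
    (hF : ∀ ω₂ lam β γ : ℝ, 0 < ω₂ → 0 < lam → 0 < β → 0 < γ → ∀ T : ℝ, 0 < T →
      ∃ μT : Measure ChainConfig, (pinnedChain ω₂ lam β γ).IsChainGibbsMeasure T μT ∧ IsShiftInvariant μT ∧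
        ∃ a ν₀ : ℝ, 0 < a ∧ 0 < ν₀ ∧ ∀ ν : ℝ, 0 < ν → ν < ν₀ →
          ∃ g : ChainConfig → ℝ, IsLocalTestFunction g ∧
            a ≤ 2 * (∑' x : ℤ, ((∫ σ, (pinnedChain ω₂ lam β γ).bondCurrentZ σ 0 * g (fun i => σ (i + x)) ∂μT) -
                      (∫ σ, (pinnedChain ω₂ lam β γ).bondCurrentZ σ 0 ∂μT) * (∫ σ, g σ ∂μT)))
                - ν * (∑' x : ℤ, ((∫ σ, g σ * g (fun i => σ (i + x)) ∂μT) - (∫ σ, g σ ∂μT) * (∫ σ, g σ ∂μT)))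
                - ν⁻¹ * (∑' x : ℤ, ((∫ σ, (pinnedChain ω₂ lam β γ).liouvilleZ g σ *
                      (pinnedChain ω₂ lam β γ).liouvilleZ g (fun i => σ (i + x)) ∂μT) -
                    (∫ σ, (pinnedChain ω₂ lam β γ).liouvilleZ g σ ∂μT) *
                      (∫ σ, (pinnedChain ω₂ lam β γ).liouvilleZ g σ ∂μT))))
    (hR : Summit.AtomisticToContinuum.FouriersLaw.Theses.StaticAbelianSqueeze.UniformAbelianRegularity) :
    Summit.AtomisticToContinuum.FouriersLaw.Theses.StaticAbelianSqueeze.ConductanceLowerBound :=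
  conductanceLowerBound_of_abelFloor_and_signedSlowRegularity
    (openChainAbelFloor_of_resolventSqueeze_of_staticAbelFloor hS hF)
    (slowRegularity_signed_of_uniformAbelianRegularity hR)

end Summit.AtomisticToContinuum.FouriersLaw.Cruxes.ConductanceLowerBound.AbelFloorExchange

end
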